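import Summits.ABC.IUTFork.Joshi.TestDictionaryFloor
import HarnessLib

/-!
# R-J census row Y-01 — `Joshi.BaseIsThetaPilot` (C1): DEFINITIONAL vs DERIVABLE, in the kernel

Record file of the abc-iut cell, branch E / R-J «JOSHI Y-DISCHARGE CENSUS» (D-0079; table of record
`plan/E/R-J/Y-CENSUS.tsv`, row Y-01; rung LADDER-ABC:A2.E; seat abc-iut-E-t18, lineage T-18 = [J-III]
arXiv:2401.13508v4 §8.9–8.11). PROOF-ONLY companion of `Joshi/Dictionary.lean` (abc-iut-E-plan, p428775) and of
abc-iut-E-t42's floor file `Joshi/TestDictionaryFloor.lean` (p429619); imports nothing else. **No side is taken** on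
[IUTchIII] Cor. 3.12 or on any author (Mochizuki / Scholze–Stix / Joshi / Dupuy–Hilado); Joshi's papers are unrefereed
preprints cited as such; typed ≠ proved; located ≠ adjudicated; NOT an abc claim.

THE ROW. Y-01 is the dictionary identification C1
`Joshi.BaseIsThetaPilot 𝔇 : Prop := 𝔇.datum 𝔇.base = (S.D P.n).Ψ` («at the base Ansatz point Joshi's datum IS the line's
Θ-pilot splitting-monoid datum of the typed Thm. 3.11 (i)(b)», OUR READING of [J-III] §6.10.1 p.53 l.11–18 «each admissible
theta-values-lift `Ξ_z` is the additive analog of Mochizuki's Θ-pilot object»; print support = ANALOGY only, E-lit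
Y-PRINT-SUPPORT v2 row Y-01). The census question (Y-CENSUS.tsv «decision route»): «decide whether any FACT-list item forces
base datum = Ψ; else record DEFINITIONAL». This file answers it over an ARBITRARY lattice situation `S`, setting `P`, region
reading `ρ` and q-datum `qK` (§§1–3), and at the pinned countermodel of record (§3):

* §1 **NOT FORCED, NOT REFUTABLE — INDEPENDENT.** For EVERY `S`, `P`: some dictionary satisfies C1 (the trivial one) and some
  dictionary violates it (constant datum := the COMPLEMENT of `Ψ_n` at every bad place; bad places exist, [IUTchI] Def. 3.1 (b),
  and star packets are `ℚ`-modules, hence inhabited) — both with `MovesAreInd ∧ DatumEquivariant ∧ StdReachable` kept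
  (`baseIsThetaPilot_independent`). Hence NO closed true proposition — a fortiori no row of the FROZEN FACT-LIST
  (plan/FACT-LIST.md, 2 826 rows frozen 2026-08-26T00:30Z, none of which mentions a Joshi-side object; every `Summits/ABC` row is
  classed R8 «never assumable») — implies C1 for the abstract dictionary (`no_true_prop_forces_baseIsThetaPilot`): C1 is a
  CONSTRAINT ON THE DICTIONARY DATUM (which Ansatz point is called `base`, and what `datum` assigns to it), i.e. DEFINITIONAL.
* §2 **WHAT X-01 ACTUALLY CONSUMES.** The FILLS-MODULO-Y skeleton X-01 (`ansatzWithinInd_of_moves`,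
  `pilotKummerIndRelated_of_ansatzWithinInd`) uses C1 only in the base case of `datum_foldr_mem`, i.e. only through its
  (Ind1),(Ind2)-saturation «`𝔇.datum 𝔇.base = D′.Ψ` for SOME possible image `D′ ∈ ⁿ˒°ℜ^LGP`» (written out as a hypothesis
  below — no new `Prop` is named): Y₁ and S are re-derived from the saturated form (`ansatzWithinInd_of_baseWithin`,
  `pilotKummerIndRelated_of_baseWithin`); the saturated form is STABLE under Joshi's moves given C2 ∧ C3 (`baseWithin_stable`)
  while C1 itself is pinned to ONE representative; and the weakening is strict EXACTLY when the indeterminacies move the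
  Θ-pilot datum, `∃ D′ ∈ ⁿ˒°ℜ^LGP, D′.Ψ ≠ Ψ_n` (`exists_baseWithin_not_base_iff`) — so C1 is definitional UP TO the very
  indeterminacies Cor. 3.12 quotients by.
* §3 **DEFINITIONAL ≠ IDLE.** Wherever S fails, the q-reading floor `constDictionary S qK` (E-t42) satisfies EVERY X-01 input
  except C1 — `MovesAreInd ∧ DatumEquivariant ∧ StdReachable ∧ StandardPointIsQPilot` — together with `¬ C1`, `¬`(saturated C1)
  and `¬ Y₁` (`baseIsThetaPilot_irredundant_of_not`); instance: abc-iut-w4-d101's pinned countermodel p419720 (typed Thm 3.11,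
  bridge hypotheses, `|log(q)| > 0`, three pins, `¬ S`; `pinned_baseIsThetaPilot_irredundant`). And at that floor the saturated
  C1 IS the datum-level (uniform) form of S, «`qK = D′.Ψ` for some possible image» (`baseWithin_const_q_iff`,
  `pilotKummerIndRelated_of_baseWithin_const_q`) — verbatim the hypothesis of branch D / team D1's
  `Charitable.D1.S_of_linkKummer_sameLine` ([IUTchIII] Thm. 3.11 (iii)(c) «L2» read at line `n`; cited, not restated): with
  Joshi's data read as the q-tuple and no contentful move, C1 is WHERE S SITS.
* §4 **MODEL CENSUS (docstring; decls of record, not re-proved here).** At every dictionary model in the tree C1 holds BY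
  CONSTRUCTION — `rfl`, or the one-step normalisation «the base point has orbit index 0 / exponent `p⁰` / coefficient at the
  point `1`»: `const_theta_baseIsThetaPilot` / `floor_baseIsThetaPilot` (TestDictionaryFloor, E-t42), `orbit_baseIsThetaPilot`
  (TestDictionaryCalibration), `pinnedDictionary_baseIsThetaPilot` (TestDictionaryPinned, E-cx), `scalDictionary_baseIsThetaPilot`
  (TestIsmScalingDictionary = X-07′), `frobColumn_baseIsThetaPilot` (TestATS2LocalPinned), `localDictionary_baseIsThetaPilot`
  (TestATS2Reading), `baseIsThetaPilot_onePoint` (DictionaryUntilts, E-t1), `baseIsThetaPilot_blind` (TestUntiltsPinned),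
  `baseIsThetaPilot_scal` (TestUntiltsFrobeniusLine), the `evenLineDictionary` / `ismLineDictionary` / `unitLineDictionary` lines
  (TestUntiltsEvenScaling, TestUntiltsIsmLine, TestUntiltsIsmLineScalar). In NONE is `datum base` computed from [J-III] §6 lifts
  `Ξ_z` independently of `Ψ_n`: the Joshi-side locus files (`ThetaJoshiAdelic`, `ThetaJoshiLocusBE`) import nothing of our side
  and defer the binding «`Ξ_z` = Θ-pilot» to `Dictionary.datum` / C1 (E-PLAN D-03, ruling R4b). A DERIVATION of C1 would need
  (i) a typed realisation map from Joshi's `B`-valued lifts into OUR `ℚ`-tensor packets — not in the tree (the packets are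
  signature carriers) — and (ii) a printed identity where print offers an analogy.

CENSUS WORD PROPOSED (E-plan's pen decides): «Y-01: CENSUS-MEMO WITH KERNEL — DEFINITIONAL (independent of every fact over
the abstract dictionary; consumed by X-01 only up to (Ind1),(Ind2); irredundant — at the q-reading floor its saturation is
datum-level S; by construction at all dictionary models of record; FACT rows used: none)». [claim: Joshi2024ATS3, status: disputed]
[claim: Mochizuki2012, status: disputed]
-/

noncomputable section

open Set

namespace Summit.ABC.IUTFork.Joshi

open Thm311 Cor312 Cor312Vol Cor312.Checks Cor312.IdentifiedNonVacuity Cor312Vol.NaiveWitness Cor312Vol.GluedMonoids.Naive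
  Literature.IUT.LogThetaLattice

/-! ## 1. C1 is independent: never forced, never refuted, over any situation -/

section Independent

variable {T : ThetaIndex} (S : LatticeSituation T) (P : Cor312.Setting S.toSituation)

/-- **The anti-Θ floor violates C1**: the move-free dictionary whose constant datum is the COMPLEMENT of `Ψ_n` at every bad
place has `¬ BaseIsThetaPilot` — at a bad place `v` ([IUTchI] Def. 3.1 (b): `V^bad ≠ ∅`) the star packet contains `0`, and
`0 ∈ Ψ_vᶜ ↔ 0 ∈ Ψ_v` is absurd. [folklore] -/
theorem not_baseIsThetaPilot_const_compl :
    ¬ BaseIsThetaPilot (constDictionary S fun v hv => ((S.D P.n).Ψ v hv)ᶜ) (P := P) := by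
  intro h
  obtain ⟨v, hv⟩ := T.Vbad_nonempty
  have hfun := (const_baseIsThetaPilot_iff S P fun v hv => ((S.D P.n).Ψ v hv)ᶜ).1 h
  have hv' : ((S.D P.n).Ψ v hv)ᶜ = (S.D P.n).Ψ v hv := congrFun (congrFun hfun v) hv
  have h0 : (0 : S.L.StarPacket v) ∈ ((S.D P.n).Ψ v hv)ᶜ ↔ (0 : S.L.StarPacket v) ∈ (S.D P.n).Ψ v hv := by
    rw [hv']
  rw [Set.mem_compl_iff] at h0
  by_cases hx : (0 : S.L.StarPacket v) ∈ (S.D P.n).Ψ v hv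
  · exact (h0.2 hx) hx
  · exact hx (h0.1 hx)

/-- **C1 is NOT FORCED**: over every lattice situation and setting, `BaseIsThetaPilot` fails for some dictionary. [folklore] -/
theorem not_forall_baseIsThetaPilot : ¬ ∀ 𝔇 : Dictionary S, BaseIsThetaPilot 𝔇 (P := P) :=
  fun h => not_baseIsThetaPilot_const_compl S P (h _)

/-- **C1 is NOT REFUTABLE either**: the trivial (Θ-reading) floor satisfies it (E-t42 `const_theta_baseIsThetaPilot`). [folklore] -/
theorem not_forall_not_baseIsThetaPilot : ¬ ∀ 𝔇 : Dictionary S, ¬ BaseIsThetaPilot 𝔇 (P := P) :=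
  fun h => h _ (const_theta_baseIsThetaPilot S P)

/-- **`baseIsThetaPilot_independent`** — both truth values of C1 are realised over EVERY situation and setting, each time
together with the other three components `MovesAreInd ∧ DatumEquivariant ∧ StdReachable` of X-01's Y₁: C1 is a constraint on
the dictionary datum, decided by nothing the situation, the setting or any closed fact carries. [folklore] -/
theorem baseIsThetaPilot_independent :
    (∃ 𝔇 : Dictionary S, MovesAreInd 𝔇 ∧ DatumEquivariant 𝔇 ∧ StdReachable 𝔇 ∧ BaseIsThetaPilot 𝔇 (P := P)) ∧
      ∃ 𝔇 : Dictionary S, MovesAreInd 𝔇 ∧ DatumEquivariant 𝔇 ∧ StdReachable 𝔇 ∧ ¬ BaseIsThetaPilot 𝔇 (P := P) :=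
  ⟨⟨_, const_movesAreInd S _, const_datumEquivariant S _, const_stdReachable S _, const_theta_baseIsThetaPilot S P⟩,
    ⟨_, const_movesAreInd S _, const_datumEquivariant S _, const_stdReachable S _,
      not_baseIsThetaPilot_const_compl S P⟩⟩

/-- **No true closed proposition forces C1** (kernel form of the row's question «does any FACT-list item force base datum =
Ψ?» for the abstract dictionary: a FACT-list row is a closed proposition taken to be true; bookkeeping corollary of
`not_forall_baseIsThetaPilot`). [folklore] -/
theorem no_true_prop_forces_baseIsThetaPilot {F : Prop} (hF : F) :
    ¬ (F → ∀ 𝔇 : Dictionary S, BaseIsThetaPilot 𝔇 (P := P)) :=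
  fun h => not_forall_baseIsThetaPilot S P (h hF)

end Independent

/-! ## 2. What X-01 consumes: C1 up to (Ind1), (Ind2) -/

section Saturation

variable {T : ThetaIndex} {S : LatticeSituation T} {P : Cor312.Setting S.toSituation}
  (ρ : (∀ v : T.V, v ∈ T.Vbad → Set (S.L.StarPacket v)) → ∀ (j : T.Label) (vQ : T.VQ), Set (S.L.Packet j vQ))
  (qK : ∀ v : T.V, v ∈ T.Vbad → Set (S.L.StarPacket v)) (𝔇 : Dictionary S)

/-- C1 implies its (Ind1),(Ind2)-saturation «the base datum is the splitting monoid of SOME possible image `D′ ∈ ⁿ˒°ℜ^LGP`»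
(with `D′ :=` the line's own data). [folklore] -/
theorem baseWithin_of_baseIsThetaPilot (hB : BaseIsThetaPilot 𝔇 (P := P)) :
    ∃ D' ∈ S.RLGP P.n, 𝔇.datum 𝔇.base = D'.Ψ :=
  ⟨S.D P.n, MRData.mem_RLGP_self _, hB⟩

/-- **`datum_foldr_mem` from the saturated C1**: transport of the base datum along any word of moves stays among the
possible images, assuming only that the base datum is SOME possible image (the seed's induction, base case relaxed).
[folklore] -/
theorem datum_foldr_mem_of_baseWithin (hB : ∃ D' ∈ S.RLGP P.n, 𝔇.datum 𝔇.base = D'.Ψ) (hM : MovesAreInd 𝔇)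
    (hE : DatumEquivariant 𝔇) (gs : List 𝔇.Move) :
    ∃ D' ∈ S.RLGP P.n, 𝔇.datum (gs.foldr 𝔇.act 𝔇.base) = D'.Ψ := by
  induction gs with
  | nil => simpa using hB
  | cons g gs ih =>
      obtain ⟨D', hD', hEq⟩ := ih
      refine ⟨D'.map (𝔇.real g), ?_, ?_⟩
      · have h1 : D'.map (𝔇.real g) ∈ D'.RLGP := MRData.map_mem_RLGP D' (hM g)
        have h2 : D'.RLGP = (S.D P.n).RLGP :=
          (MRData.RLGP_eq_iff _ _).2 (Relation.EqvGen.symm _ _ hD')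
        simpa [Situation.RLGP, h2] using h1
      · funext v hv
        simp only [List.foldr_cons]
        rw [hE g _ v hv, hEq]
        rfl

/-- **The saturated C1 is STABLE under Joshi's moves** (given C2 `MovesAreInd` and C3 `DatumEquivariant`): the datum of any
moved base point is again the splitting monoid of a possible image — whereas C1 itself names ONE representative and is lost
along a contentful move (X-07′: the moved datum is a rescaled `Ψ`). [folklore] -/
theorem baseWithin_stable (hB : ∃ D' ∈ S.RLGP P.n, 𝔇.datum 𝔇.base = D'.Ψ) (hM : MovesAreInd 𝔇)
    (hE : DatumEquivariant 𝔇) (g : 𝔇.Move) :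
    ∃ D' ∈ S.RLGP P.n, 𝔇.datum (𝔇.act g 𝔇.base) = D'.Ψ := by
  simpa using datum_foldr_mem_of_baseWithin 𝔇 hB hM hE [g]

/-- **Y₁ from the saturated C1** + C2 + C3 + C4: X-01's first half survives the weakening of C1 to its
(Ind1),(Ind2)-saturation — this is all of C1 the test consumes. [folklore] -/
theorem ansatzWithinInd_of_baseWithin (hB : ∃ D' ∈ S.RLGP P.n, 𝔇.datum 𝔇.base = D'.Ψ) (hM : MovesAreInd 𝔇)
    (hE : DatumEquivariant 𝔇) (hR : StdReachable 𝔇) : AnsatzWithinInd ρ 𝔇 (P := P) := by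
  obtain ⟨gs, hgs⟩ := hR
  obtain ⟨D', hD', hEq⟩ := datum_foldr_mem_of_baseWithin 𝔇 hB hM hE gs
  exact ⟨D', hD', fun j vQ => by rw [← hgs, hEq]⟩

/-- **S through X-01 from the saturated C1** (+ C2, C3, C4 and Y₂): kernel glue only, no Joshi claim and no clause of
Cor. 3.12 asserted. [folklore] -/
theorem pilotKummerIndRelated_of_baseWithin (hB : ∃ D' ∈ S.RLGP P.n, 𝔇.datum 𝔇.base = D'.Ψ) (hM : MovesAreInd 𝔇)
    (hE : DatumEquivariant 𝔇) (hR : StdReachable 𝔇) (h2 : StandardPointIsQPilot ρ qK 𝔇) :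
    PilotKummerIndRelated S P ρ qK :=
  pilotKummerIndRelated_of_ansatzWithinInd ρ qK 𝔇 (ansatzWithinInd_of_baseWithin ρ 𝔇 hB hM hE hR) h2

variable (S P)

/-- **When is the weakening strict?** Some dictionary has the saturated C1 but not C1 IFF the indeterminacies MOVE the
Θ-pilot's splitting-monoid datum, i.e. some possible image `D′ ∈ ⁿ˒°ℜ^LGP` has `D′.Ψ ≠ Ψ_n` — the contentful situations
(valuation-rescaling (Ind2), X-07′); where every possible image carries the same `Ψ` (indeterminacies acting by signs on a
sign-stable datum, the pinned profile) C1 and its saturation coincide. So C1 is definitional UP TO (Ind1),(Ind2). [folklore] -/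
theorem exists_baseWithin_not_base_iff :
    (∃ 𝔇 : Dictionary S, (∃ D' ∈ S.RLGP P.n, 𝔇.datum 𝔇.base = D'.Ψ) ∧ ¬ BaseIsThetaPilot 𝔇 (P := P)) ↔
      ∃ D' ∈ S.RLGP P.n, D'.Ψ ≠ (S.D P.n).Ψ := by
  constructor
  · rintro ⟨𝔇, ⟨D', hD', hEq⟩, hB⟩
    exact ⟨D', hD', fun h => hB (hEq.trans h)⟩
  · rintro ⟨D', hD', hne⟩
    exact ⟨constDictionary S D'.Ψ, ⟨D', hD', rfl⟩, fun h => hne ((const_baseIsThetaPilot_iff S P D'.Ψ).1 h)⟩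

/-- In particular every dictionary's saturated C1 already IS C1 when no indeterminacy moves `Ψ_n`. [folklore] -/
theorem baseIsThetaPilot_of_baseWithin_of_rigid (hrig : ∀ D' ∈ S.RLGP P.n, D'.Ψ = (S.D P.n).Ψ) (𝔇 : Dictionary S)
    (hB : ∃ D' ∈ S.RLGP P.n, 𝔇.datum 𝔇.base = D'.Ψ) : BaseIsThetaPilot 𝔇 (P := P) := by
  obtain ⟨D', hD', hEq⟩ := hB
  exact hEq.trans (hrig D' hD')

end Saturation

/-! ## 3. Definitional ≠ idle: C1 is the load-bearing input of X-01 wherever S fails -/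

section Irredundant

variable {T : ThetaIndex} (S : LatticeSituation T) (P : Cor312.Setting S.toSituation)
  (ρ : (∀ v : T.V, v ∈ T.Vbad → Set (S.L.StarPacket v)) → ∀ (j : T.Label) (vQ : T.VQ), Set (S.L.Packet j vQ))
  (qK : ∀ v : T.V, v ∈ T.Vbad → Set (S.L.StarPacket v))

/-- At the q-reading floor `constDictionary S qK` («Joshi's data = the q-tuple», E-PLAN §3 X-02) the saturated C1 reads
«`qK = D′.Ψ` for some possible image `D′ ∈ ⁿ˒°ℜ^LGP`» — the DATUM-level (uniform in `(j, v_ℚ)`, `ρ`-free) form of S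
(bookkeeping, `Iff.rfl`). This is VERBATIM the hypothesis of branch D / team D1's `Charitable.D1.S_of_linkKummer_sameLine`
(Thm311D1Derive.lean: [IUTchIII] Thm. 3.11 (iii)(c) final clause «L2» read at line `n` ⊢ S, the minimal sub-conjunction of
the charitable re-typing) — cited by name, not restated. [folklore] -/
theorem baseWithin_const_q_iff :
    (∃ D' ∈ S.RLGP P.n, (constDictionary S qK).datum (constDictionary S qK).base = D'.Ψ) ↔
      ∃ D' ∈ S.RLGP P.n, qK = D'.Ψ :=
  Iff.rfl

/-- Granting C1's saturation to the q-reading floor GIVES S through X-01 (Y₂ there by `rfl`, C2–C4 vacuous / empty word):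
at `base = std` the whole of X-01 collapses onto this one input. [folklore] -/
theorem pilotKummerIndRelated_of_baseWithin_const_q
    (hB : ∃ D' ∈ S.RLGP P.n, (constDictionary S qK).datum (constDictionary S qK).base = D'.Ψ) :
    PilotKummerIndRelated S P ρ qK :=
  pilotKummerIndRelated_of_baseWithin ρ qK (constDictionary S qK) hB (const_movesAreInd S _)
    (const_datumEquivariant S _) (const_stdReachable S _) (const_q_standardPointIsQPilot S ρ qK)

/-- Hence wherever S fails the q-reading floor violates the saturated C1 … [folklore] -/
theorem not_baseWithin_const_q_of_not (h : ¬ PilotKummerIndRelated S P ρ qK) :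
    ¬ ∃ D' ∈ S.RLGP P.n, (constDictionary S qK).datum (constDictionary S qK).base = D'.Ψ :=
  fun hB => h (pilotKummerIndRelated_of_baseWithin_const_q S P ρ qK hB)

/-- … and violates C1 itself. [folklore] -/
theorem not_baseIsThetaPilot_const_q_of_not (h : ¬ PilotKummerIndRelated S P ρ qK) :
    ¬ BaseIsThetaPilot (constDictionary S qK) (P := P) :=
  fun hB => not_baseWithin_const_q_of_not S P ρ qK h (baseWithin_of_baseIsThetaPilot (constDictionary S qK) hB)

/-- **`baseIsThetaPilot_irredundant_of_not` — C1 is NOT IDLE in X-01.** Wherever S fails there is a dictionary satisfying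
EVERY other input of X-01 — C2 `MovesAreInd`, C3 `DatumEquivariant`, C4 `StdReachable` and Y₂ `StandardPointIsQPilot` —
together with `¬` C1, `¬`(saturated C1) and `¬` Y₁: the q-reading floor. So «definitional» does not mean «removable»: with
Joshi's data read as the q-tuple and no contentful move, C1 (up to (Ind1),(Ind2)) is exactly where S sits. [folklore] -/
theorem baseIsThetaPilot_irredundant_of_not (h : ¬ PilotKummerIndRelated S P ρ qK) :
    ∃ 𝔇 : Dictionary S, MovesAreInd 𝔇 ∧ DatumEquivariant 𝔇 ∧ StdReachable 𝔇 ∧ StandardPointIsQPilot ρ qK 𝔇 ∧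
      ¬ BaseIsThetaPilot 𝔇 (P := P) ∧ ¬ (∃ D' ∈ S.RLGP P.n, 𝔇.datum 𝔇.base = D'.Ψ) ∧
      ¬ AnsatzWithinInd ρ 𝔇 (P := P) :=
  ⟨constDictionary S qK, const_movesAreInd S _, const_datumEquivariant S _, const_stdReachable S _,
    const_q_standardPointIsQPilot S ρ qK, not_baseIsThetaPilot_const_q_of_not S P ρ qK h,
    not_baseWithin_const_q_of_not S P ρ qK h, const_q_not_ansatzWithinInd S P ρ qK h⟩

end Irredundant

/-! ### Instance: the pinned countermodel of record (abc-iut-w4-d101, p419720) -/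

section Pinned

variable (p : ℕ) [hp : Fact p.Prime]

/-- **`pinned_baseIsThetaPilot_irredundant`** — at the pinned countermodel of record (typed [IUTchIII] Thm. 3.11 (i)–(iii) for
the naive situation, every bridge hypothesis, `|log(q)| > 0`, the THREE pins, and `¬ S`), the q-reading floor has
C2 ∧ C3 ∧ C4 ∧ Y₂ and `¬` C1, `¬`(saturated C1), `¬` Y₁: every X-01 input but C1 is jointly satisfiable with the typed
Theorem 3.11, the pins and `¬ S`. Located, not adjudicated. [claim: Mochizuki2012, status: disputed] -/
theorem pinned_baseIsThetaPilot_irredundant :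
    (naiveFull p).Statement ∧ BridgeHyps (PinnedWitness.pinnedSetting p) ∧ (PinnedWitness.pinnedSetting p).AbsLogQPos ∧
      PinnedRegions3 (naiveFull p).toLatticeSituation (PinnedWitness.pinnedSetting p) (PinnedWitness.orbitRegion p)
        (PinnedWitness.qDatum p) ∧
      ¬ PilotKummerIndRelated (naiveFull p).toLatticeSituation (PinnedWitness.pinnedSetting p) (PinnedWitness.orbitRegion p)
        (PinnedWitness.qDatum p) ∧
      ∃ 𝔇 : Dictionary (naiveFull p).toLatticeSituation,
        MovesAreInd 𝔇 ∧ DatumEquivariant 𝔇 ∧ StdReachable 𝔇 ∧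
        StandardPointIsQPilot (PinnedWitness.orbitRegion p) (PinnedWitness.qDatum p) 𝔇 ∧
        ¬ BaseIsThetaPilot 𝔇 (P := PinnedWitness.pinnedSetting p) ∧
        ¬ (∃ D' ∈ (naiveFull p).toLatticeSituation.RLGP (PinnedWitness.pinnedSetting p).n, 𝔇.datum 𝔇.base = D'.Ψ) ∧
        ¬ AnsatzWithinInd (PinnedWitness.orbitRegion p) 𝔇 (P := PinnedWitness.pinnedSetting p) :=
  ⟨naiveFull_statement p, PinnedWitness.pinnedSetting_bridgeHyps p, PinnedWitness.pinnedSetting_absLogQPos p,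
    PinnedWitness.pinnedSetting_pinnedRegions3 p, PinnedWitness.pinnedSetting_not_pilotKummerIndRelated p,
    baseIsThetaPilot_irredundant_of_not _ _ _ _ (PinnedWitness.pinnedSetting_not_pilotKummerIndRelated p)⟩

/-- … while the Θ-reading floor there keeps C1 (and Y₁) and loses Y₂ (E-t42 `pinned_moveFree_split`): at a move-free
dictionary the pair (C1, Y₂) cannot both hold where S fails — C1 and Y₂ trade places as the carrier of S. [folklore] -/
theorem pinned_baseIsThetaPilot_theta_reading :
    BaseIsThetaPilot (constDictionary (naiveFull p).toLatticeSituation ((naiveFull p).D (PinnedWitness.pinnedSetting p).n).Ψ)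
        (P := PinnedWitness.pinnedSetting p) ∧
      ¬ StandardPointIsQPilot (PinnedWitness.orbitRegion p) (PinnedWitness.qDatum p)
        (constDictionary (naiveFull p).toLatticeSituation ((naiveFull p).D (PinnedWitness.pinnedSetting p).n).Ψ) :=
  ⟨const_theta_baseIsThetaPilot _ _, pinned_theta_not_standardPointIsQPilot p⟩

end Pinned

end Summit.ABC.IUTFork.Joshi

end
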